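import Mathlib
import HarnessLib
import Literature.Geometry.DiscreteGeometry.KissingPatterns
import Literature.Geometry.DiscreteGeometry.KissingRigidity

/-!
# The orientation bit of a bond star is chart-independent (crux `SoftLayerPropagation`, line `Sketch`)

Route `PricedLinkCensus`, crux `SoftLayerPropagation` (stmt-AtomisticToContinuum-14233), line
`Sketch`, helper file for the stub `stub_shadow` (development of the exact shadow crystal), first
half of the TRANSITION LEMMA between the charts of two bonded sites (completed in
`…StubShadowTransition.lean`): registered sub-goal `shadow_starDistances`.

Setting.  Two bonded sites `j ~ k` of a configuration `y : Fin n → ℝ³` carry exact labelled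
charts (conclusion of `stub_chartAssembly`), written here over INTEGER kissing models `(S, N)`,
`(S', N')` (`fccInt`/`hcpInt`, pattern point `v/√N`): `m : ℤ³ → Fin n` labels the model points
by bond-neighbours of `j`, the site `m v` sits within `ν/4` of `y j + ν • A (v/√N)` (`ν = nn_j`,
`A` a linear isometry), `m` is injective on `S`, and two labelled sites are bonded iff their labels
are model contacts `|v − w|² = N`; likewise `(m', A', ν')` at `k`.  The label `v₀` of `k` at `j`
has exactly the four common neighbours as contacts, and so has the label `v₀'` of `j` at `k`;
the induced correspondence of labels preserves contacts (both charts read one bond graph).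

Claim (`shadow_starDistances`).  The correspondence preserves ALL squared distances among the
four common neighbours: `|q − q'|² · N' = |Q − Q'|² · N` for corresponding non-adjacent pairs.
The tables of `…StubShadowPatterns.lean` reduce this to one bit: in a star made of two disjoint
contact edges `q ~ r₁`, `q' ~ r₂` (every FCC bond, the cap bonds of HCP) the two edges are
parallel, and WHICH orientation (`q − r₁ = q' − r₂`, a square diagonal `√2`, or `q − r₁ = r₂ − q'`,
an opposite pair `√3`) cannot be read off distances at tolerance `nn/4` (`4 · ¼ > √3 − √2`) — but
it is read off a SIGN: the chart at `j` puts the real edge vectors `y(m q) − y(m r₁)` and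
`y(m q') − y(m r₂)` both within `ν/2` of one vector of norm `ν`, so their inner product is
`≥ ν²/4 > 0` (`inner_ge_of_near_common`: the ball `B(w, ν/2)` subtends `30°`), while a chart at
`k` with the opposite orientation would make it `≤ 0` (`chart_parallel_clash`).  All `[folklore]`.
-/

noncomputable section

namespace Summit.AtomisticToContinuum.Crystallization.Theorems

open Literature.Geometry.DiscreteGeometry
open RealInnerProductSpace

/-! ### The sign lemma -/

/-- **Sign lemma.**  Two vectors each within `ν/2` of a vector `w` of norm `ν` have inner product
`≥ ν²/4`: the ball `B(w, ν/2)` subtends `30°` at the origin. [folklore] -/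
theorem inner_ge_of_near_common {E : Type*} [NormedAddCommGroup E] [InnerProductSpace ℝ E]
    {a b w : E} {ν : ℝ} (hw : ‖w‖ = ν) (ha : ‖a - w‖ ≤ ν / 2) (hb : ‖b - w‖ ≤ ν / 2) :
    ν ^ 2 / 4 ≤ ⟪a, b⟫ := by
  have hν : 0 ≤ ν := by rw [← hw]; exact norm_nonneg _
  have h1 : ⟪a, w⟫ = (‖a‖ ^ 2 + ‖w‖ ^ 2 - ‖a - w‖ ^ 2) / 2 := by
    rw [norm_sub_sq_real]; ring
  have h2 : |⟪a, b - w⟫| ≤ ‖a‖ * ‖b - w‖ := abs_real_inner_le_norm _ _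
  have h3 : ⟪a, b⟫ = ⟪a, w⟫ + ⟪a, b - w⟫ := by rw [inner_sub_right]; ring
  have h4 : ‖a‖ * ‖b - w‖ ≤ ‖a‖ * (ν / 2) := mul_le_mul_of_nonneg_left hb (norm_nonneg _)
  have h5 : ‖a - w‖ ^ 2 ≤ (ν / 2) ^ 2 := pow_le_pow_left₀ (norm_nonneg _) ha 2
  have h6 : -(‖a‖ * ‖b - w‖) ≤ ⟪a, b - w⟫ := (abs_le.1 h2).1
  rw [h3, h1, hw]
  nlinarith [sq_nonneg (‖a‖ - ν / 2)]

/-- **Chart differences.**  If two sites are within `ν/4` of their ideal positions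
`c + ν • A p₁`, `c + ν • A p₂`, their difference is within `ν/2` of `ν • A (p₁ − p₂)`. [folklore] -/
theorem norm_sub_sub_smul_le {c x₁ x₂ p₁ p₂ : EuclideanSpace ℝ (Fin 3)} {ν : ℝ}
    {A : EuclideanSpace ℝ (Fin 3) →ₗᵢ[ℝ] EuclideanSpace ℝ (Fin 3)}
    (h₁ : dist x₁ (c + ν • A p₁) ≤ ν / 4) (h₂ : dist x₂ (c + ν • A p₂) ≤ ν / 4) :
    ‖(x₁ - x₂) - ν • A (p₁ - p₂)‖ ≤ ν / 2 := by
  have : (x₁ - x₂) - ν • A (p₁ - p₂) = (x₁ - (c + ν • A p₁)) - (x₂ - (c + ν • A p₂)) := by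
    rw [map_sub, smul_sub]; abel
  rw [this]
  calc ‖(x₁ - (c + ν • A p₁)) - (x₂ - (c + ν • A p₂))‖
      ≤ ‖x₁ - (c + ν • A p₁)‖ + ‖x₂ - (c + ν • A p₂)‖ := norm_sub_le _ _
    _ ≤ ν / 4 + ν / 4 := add_le_add (by rwa [← dist_eq_norm]) (by rwa [← dist_eq_norm])
    _ = ν / 2 := by ring

/-- **No antiparallel relabelling.**  Four sites `s₁, s₂, s₃, s₄` seen in two charts: in the chart
about `c` (scale `ν > 0`) with labels `p₁, p₂, p₃, p₄`, `‖p₁ − p₂‖ = 1` and `p₁ − p₂ = p₃ − p₄`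
(parallel unit edges), in the chart about `c'` with labels `pᵢ'`, `‖p₁' − p₂'‖ = 1` and
`p₁' − p₂' = p₄' − p₃'` (ANTIparallel).  Impossible: the first chart makes
`⟪y s₁ − y s₂, y s₃ − y s₄⟫ > 0`, the second makes it `≤ 0` (sign lemma). [folklore] -/
theorem chart_parallel_clash {n : ℕ} {y : Fin n → EuclideanSpace ℝ (Fin 3)}
    {c c' : EuclideanSpace ℝ (Fin 3)} {ν ν' : ℝ} (hν : 0 < ν)
    {A A' : EuclideanSpace ℝ (Fin 3) →ₗᵢ[ℝ] EuclideanSpace ℝ (Fin 3)} {s₁ s₂ s₃ s₄ : Fin n}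
    {p₁ p₂ p₃ p₄ p₁' p₂' p₃' p₄' : EuclideanSpace ℝ (Fin 3)}
    (h₁ : dist (y s₁) (c + ν • A p₁) ≤ ν / 4) (h₂ : dist (y s₂) (c + ν • A p₂) ≤ ν / 4)
    (h₃ : dist (y s₃) (c + ν • A p₃) ≤ ν / 4) (h₄ : dist (y s₄) (c + ν • A p₄) ≤ ν / 4)
    (h₁' : dist (y s₁) (c' + ν' • A' p₁') ≤ ν' / 4) (h₂' : dist (y s₂) (c' + ν' • A' p₂') ≤ ν' / 4)
    (h₃' : dist (y s₃) (c' + ν' • A' p₃') ≤ ν' / 4) (h₄' : dist (y s₄) (c' + ν' • A' p₄') ≤ ν' / 4)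
    (hd : ‖p₁ - p₂‖ = 1) (hd' : ‖p₁' - p₂'‖ = 1)
    (hpar : p₁ - p₂ = p₃ - p₄) (hanti : p₁' - p₂' = p₄' - p₃') : False := by
  have hν' : 0 ≤ ν' := by linarith [dist_nonneg.trans h₁']
  -- chart about `c`: both differences near `w = ν • A (p₁ - p₂)`
  have hw : ‖ν • A (p₁ - p₂)‖ = ν := by
    rw [norm_smul, LinearIsometry.norm_map, hd, mul_one, Real.norm_of_nonneg hν.le]
  have ha := norm_sub_sub_smul_le h₁ h₂
  have hb := norm_sub_sub_smul_le h₃ h₄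
  rw [← hpar] at hb
  have hpos := inner_ge_of_near_common hw ha hb
  -- chart about `c'`: `a` and `-b` near `w' = ν' • A' (p₁' - p₂')`
  have hw' : ‖ν' • A' (p₁' - p₂')‖ = ν' := by
    rw [norm_smul, LinearIsometry.norm_map, hd', mul_one, Real.norm_of_nonneg hν']
  have ha' := norm_sub_sub_smul_le h₁' h₂'
  have hb' := norm_sub_sub_smul_le h₄' h₃'
  rw [← hanti] at hb'
  have hneg := inner_ge_of_near_common hw' ha' hb'
  have : ⟪y s₁ - y s₂, y s₄ - y s₃⟫ = -⟪y s₁ - y s₂, y s₃ - y s₄⟫ := by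
    rw [← inner_neg_right, neg_sub]
  rw [this] at hneg
  nlinarith [sq_nonneg ν']

/-! ### Scaled integer points -/

/-- The scaled point `v/√N` has norm `1` if `|v|² = N`. [folklore] -/
theorem norm_scaled_intVec {N : ℕ} (hN : N ≠ 0) {v : Fin 3 → ℤ} (hv : sqNormInt v = N) :
    ‖((Real.sqrt N)⁻¹ • intVec v : EuclideanSpace ℝ (Fin 3))‖ = 1 := by
  have hpos : (0 : ℝ) < Real.sqrt N := by positivity
  rw [norm_smul, norm_inv, Real.norm_of_nonneg hpos.le, norm_intVec, hv, Int.cast_natCast,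
    inv_mul_cancel₀ hpos.ne']

/-- Scaling is linear: `(v − w)/√N = v/√N − w/√N`. [folklore] -/
theorem scaled_intVec_sub (N : ℕ) (v w : Fin 3 → ℤ) :
    ((Real.sqrt N)⁻¹ • intVec (v - w) : EuclideanSpace ℝ (Fin 3)) =
      (Real.sqrt N)⁻¹ • intVec v - (Real.sqrt N)⁻¹ • intVec w := by
  rw [← intVec_sub, smul_sub]

/-- `|v − w|² = |v|² + |w|² − 2 v·w` in `ℤ³`. [folklore] -/
theorem sqNormInt_sub_eq (v w : Fin 3 → ℤ) :
    sqNormInt (v - w) = sqNormInt v + sqNormInt w - 2 * dotInt v w := by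
  simp only [sqNormInt, dotInt, Pi.sub_apply]; ring

/-! ### Reference points of the integer models -/

/-- Contacts of an integer model have inner product `2` at reference scale (`‖refPt‖ = 2`).
[folklore] -/
theorem inner_refPt_of_contact {N : ℕ} (hN : N ≠ 0) {v w : Fin 3 → ℤ} (hv : sqNormInt v = N)
    (hw : sqNormInt w = N) (hvw : sqNormInt (v - w) = N) : ⟪refPt N v, refPt N w⟫ = 2 := by
  have h := sqNormInt_sub_eq v w
  rw [hvw, hv, hw] at h
  have hd : (2 : ℝ) * dotInt v w = N := by
    have : 2 * dotInt v w = (N : ℤ) := by linarith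
    exact_mod_cast this
  rw [inner_refPt]
  have hN' : (N : ℝ) ≠ 0 := by exact_mod_cast hN
  field_simp
  linarith

/-- In general `⟪refPt N v, refPt N w⟫ = 4 − 2 |v − w|² / N` for `v, w` of squared norm `N`.
[folklore] -/
theorem inner_refPt_eq {N : ℕ} (hN : N ≠ 0) {v w : Fin 3 → ℤ} (hv : sqNormInt v = N)
    (hw : sqNormInt w = N) :
    ⟪refPt N v, refPt N w⟫ = 4 - 2 * (sqNormInt (v - w) : ℝ) / N := by
  have h := sqNormInt_sub_eq v w
  rw [hv, hw] at h
  have hd : (2 : ℝ) * dotInt v w = 2 * N - sqNormInt (v - w) := by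
    have : 2 * dotInt v w = 2 * (N : ℤ) - sqNormInt (v - w) := by linarith
    exact_mod_cast this
  rw [inner_refPt]
  have hN' : (N : ℝ) ≠ 0 := by exact_mod_cast hN
  field_simp
  linarith

/-- `‖refPt N v‖² = 4`, as an inner product. [folklore] -/
theorem inner_refPt_self {N : ℕ} (hN : N ≠ 0) {v : Fin 3 → ℤ} (hv : sqNormInt v = N) :
    ⟪refPt N v, refPt N v⟫ = 4 := by
  rw [real_inner_self_eq_norm_sq, norm_refPt hN hv]; norm_num

/-- `refPt N v = 2 • (v/√N)`. [folklore] -/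
theorem refPt_eq_two_smul (N : ℕ) (v : Fin 3 → ℤ) :
    refPt N v = (2 : ℝ) • ((Real.sqrt N)⁻¹ • intVec v : EuclideanSpace ℝ (Fin 3)) := rfl

/-! ### Squared distances in the bond star are chart-independent -/

/-- **Registered sub-goal `shadow_starDistances`** of the crux item: for two charts over integer
kissing models at bonded sites `j ~ k` (labels `m`, `m'`; `v₀` the label of `k` at `j`, `v₀'` the
label of `j` at `k`), corresponding non-adjacent labels `q ↔ Q`, `q' ↔ Q'` of common neighbours
satisfy `|q − q'|² N' = |Q − Q'|² N`, provided the model `(S, N)` satisfies the exhaustion table and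
`(S', N')` the four witness tables of `…StubShadowPatterns.lean`.  (Witnesses are transported
along the common bond graph; the orientation bit by `chart_parallel_clash`.) [folklore] -/
theorem shadow_starDistances :  open Literature.Geometry.DiscreteGeometry in ∀ (S S' : Finset (Fin 3
    → ℤ)) (N N' : ℕ), N ≠ 0 → N' ≠ 0 → (∀ v₀ ∈ S, ∀ q ∈ S, sqNormInt (v₀ - q) = N → ∀ q' ∈ S,
    (sqNormInt (v₀ - q') = N ∧ q ≠ q' ∧ sqNormInt (q - q') ≠ N) → (∃ r ∈ S, sqNormInt (v₀ - r) = N ∧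
    sqNormInt (q - r) = N ∧ sqNormInt (q' - r) = N ∧ 3 * sqNormInt (q - q') = 8 * N) ∨ (∃ r₁ ∈ S, ∃
    r₂ ∈ S, sqNormInt (v₀ - r₁) = N ∧ sqNormInt (v₀ - r₂) = N ∧ sqNormInt (q' - r₁) = N ∧ sqNormInt
    (q - r₁) ≠ N ∧ r₂ ≠ q ∧ r₂ ≠ q' ∧ sqNormInt (q - r₂) ≠ N ∧ sqNormInt (q' - r₂) ≠ N ∧ sqNormInt
    (r₁ - r₂) = N ∧ sqNormInt (q - q') = 2 * N) ∨ (∃ r₁ ∈ S, ∃ r₂ ∈ S, sqNormInt (v₀ - r₁) = N ∧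
    sqNormInt (v₀ - r₂) = N ∧ sqNormInt (q - r₁) = N ∧ sqNormInt (q' - r₁) ≠ N ∧ r₂ ≠ q' ∧ r₂ ≠ q ∧
    sqNormInt (q' - r₂) ≠ N ∧ sqNormInt (q - r₂) ≠ N ∧ sqNormInt (r₁ - r₂) = N ∧ sqNormInt (q - q')
    = 2 * N) ∨ (∃ r₁ ∈ S, ∃ r₂ ∈ S, sqNormInt (v₀ - r₁) = N ∧ sqNormInt (v₀ - r₂) = N ∧ r₁ ≠ r₂ ∧
    sqNormInt (q' - r₁) = N ∧ sqNormInt (q' - r₂) = N ∧ sqNormInt (q - r₁) ≠ N ∧ sqNormInt (q - r₂)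
    ≠ N ∧ sqNormInt (q - q') = 3 * N) ∨ (∃ r₁ ∈ S, ∃ r₂ ∈ S, sqNormInt (v₀ - r₁) = N ∧ sqNormInt (v₀
    - r₂) = N ∧ r₁ ≠ r₂ ∧ sqNormInt (q - r₁) = N ∧ sqNormInt (q - r₂) = N ∧ sqNormInt (q' - r₁) ≠ N
    ∧ sqNormInt (q' - r₂) ≠ N ∧ sqNormInt (q - q') = 3 * N) ∨ (∃ r₁ ∈ S, ∃ r₂ ∈ S, sqNormInt (v₀ -
    r₁) = N ∧ sqNormInt (v₀ - r₂) = N ∧ r₁ ≠ r₂ ∧ sqNormInt (q - r₁) = N ∧ sqNormInt (q' - r₂) = N ∧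
    sqNormInt (r₁ - r₂) ≠ N ∧ sqNormInt (q' - r₁) ≠ N ∧ sqNormInt (q - r₂) ≠ N ∧ ((q - r₁ = q' - r₂
    ∧ sqNormInt (q - q') = 2 * N) ∨ (q - r₁ = r₂ - q' ∧ sqNormInt (q - q') = 3 * N)))) → (∀ v₀ ∈ S',
    ∀ q ∈ S', sqNormInt (v₀ - q) = N' → ∀ q' ∈ S', (sqNormInt (v₀ - q') = N' ∧ q ≠ q' ∧ sqNormInt (q
    - q') ≠ N') → ∀ r ∈ S', (sqNormInt (v₀ - r) = N' ∧ sqNormInt (q - r) = N' ∧ sqNormInt (q' - r) =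
    N') → 3 * sqNormInt (q - q') = 8 * N') → (∀ v₀ ∈ S', ∀ q ∈ S', sqNormInt (v₀ - q) = N' → ∀ q' ∈
    S', (sqNormInt (v₀ - q') = N' ∧ q ≠ q' ∧ sqNormInt (q - q') ≠ N') → ∀ r₁ ∈ S', (sqNormInt (v₀ -
    r₁) = N' ∧ sqNormInt (q' - r₁) = N' ∧ sqNormInt (q - r₁) ≠ N') → ∀ r₂ ∈ S', (sqNormInt (v₀ - r₂)
    = N' ∧ r₂ ≠ q ∧ r₂ ≠ q' ∧ sqNormInt (q - r₂) ≠ N' ∧ sqNormInt (q' - r₂) ≠ N' ∧ sqNormInt (r₁ -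
    r₂) = N') → sqNormInt (q - q') = 2 * N') → (∀ v₀ ∈ S', ∀ q ∈ S', sqNormInt (v₀ - q) = N' → ∀ q'
    ∈ S', (sqNormInt (v₀ - q') = N' ∧ q ≠ q' ∧ sqNormInt (q - q') ≠ N') → ∀ r₁ ∈ S', (sqNormInt (v₀
    - r₁) = N' ∧ sqNormInt (q' - r₁) = N' ∧ sqNormInt (q - r₁) ≠ N') → ∀ r₂ ∈ S', (sqNormInt (v₀ -
    r₂) = N' ∧ r₁ ≠ r₂ ∧ sqNormInt (q' - r₂) = N' ∧ sqNormInt (q - r₂) ≠ N') → sqNormInt (q - q') =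
    3 * N') → (∀ v₀ ∈ S', ∀ q ∈ S', sqNormInt (v₀ - q) = N' → ∀ q' ∈ S', (sqNormInt (v₀ - q') = N' ∧
    q ≠ q' ∧ sqNormInt (q - q') ≠ N') → ∀ r₁ ∈ S', (sqNormInt (v₀ - r₁) = N' ∧ sqNormInt (q - r₁) =
    N' ∧ sqNormInt (q' - r₁) ≠ N') → ∀ r₂ ∈ S', (sqNormInt (v₀ - r₂) = N' ∧ r₁ ≠ r₂ ∧ sqNormInt (q'
    - r₂) = N' ∧ sqNormInt (r₁ - r₂) ≠ N' ∧ sqNormInt (q - r₂) ≠ N') → (q - r₁ = q' - r₂ ∧ sqNormInt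
    (q - q') = 2 * N') ∨ (q - r₁ = r₂ - q' ∧ sqNormInt (q - q') = 3 * N')) → ∀ (n : ℕ) (y : Fin n →
    EuclideanSpace ℝ (Fin 3)) (G : SimpleGraph (Fin n)) (j k : Fin n) (ν ν' : ℝ), 0 < ν → ∀ (A A' :
    EuclideanSpace ℝ (Fin 3) →ₗᵢ[ℝ] EuclideanSpace ℝ (Fin 3)) (m m' : (Fin 3 → ℤ) → Fin n), (∀ v ∈
    S, G.Adj j (m v) ∧ dist (y (m v)) (y j + ν • A ((Real.sqrt N)⁻¹ • intVec v)) ≤ ν / 4) → (∀ v ∈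
    S, ∀ w ∈ S, m v = m w → v = w) → (∀ v ∈ S, ∀ w ∈ S, (G.Adj (m v) (m w) ↔ sqNormInt (v - w) = N))
    → (∀ v ∈ S', G.Adj k (m' v) ∧ dist (y (m' v)) (y k + ν' • A' ((Real.sqrt N')⁻¹ • intVec v)) ≤ ν'
    / 4) → (∀ v ∈ S', ∀ w ∈ S', (G.Adj (m' v) (m' w) ↔ sqNormInt (v - w) = N')) → (∀ l, G.Adj k l →
    ∃ v ∈ S', m' v = l) → ∀ v₀ ∈ S, m v₀ = k → ∀ v₀' ∈ S', m' v₀' = j → ∀ q ∈ S, ∀ q' ∈ S, ∀ Q ∈ S',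
    ∀ Q' ∈ S', m q = m' Q → m q' = m' Q' → q ≠ q' → sqNormInt (q - q') ≠ N → sqNormInt (q - q') * N'
    = sqNormInt (Q - Q') * N := by
  intro S S' N N' hN hN' hX hA' hB' hC' hD' n y G j k ν ν' hν A A' m m' C2 C3 C4 C2' C4' C5'
    v₀ hv₀ hv₀k v₀' hv₀' hv₀'j
  have sqNormInt_sub_comm : ∀ v w : Fin 3 → ℤ, sqNormInt (v - w) = sqNormInt (w - v) :=
    fun v w => by simp only [sqNormInt, Pi.sub_apply]; ring
  /- Step A: transport of labels along the common bond graph. -/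
  -- a `k`-chart label of a site is a contact of `v₀'`, its `j`-chart label a contact of `v₀`
  have nbr_of_label : ∀ v ∈ S, ∀ v' ∈ S', m v = m' v' →
      sqNormInt (v₀ - v) = N ∧ sqNormInt (v₀' - v') = N' := by
    intro v hv v' hv' h
    constructor
    · rw [← C4 v₀ hv₀ v hv, hv₀k, h]; exact (C2' v' hv').1
    · rw [← C4' v₀' hv₀' v' hv', hv₀'j, ← h]; exact (C2 v hv).1
  -- every contact of `v₀` has a `k`-chart label
  have transport : ∀ v ∈ S, sqNormInt (v₀ - v) = N →
      ∃ v' ∈ S', m v = m' v' ∧ sqNormInt (v₀' - v') = N' := by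
    intro v hv h
    have hadj : G.Adj k (m v) := by rw [← hv₀k]; exact (C4 v₀ hv₀ v hv).2 h
    obtain ⟨v', hv', hmv'⟩ := C5' _ hadj
    exact ⟨v', hv', hmv'.symm, (nbr_of_label v hv v' hv' hmv'.symm).2⟩
  -- contacts and (in)equalities of labels are read off the sites
  have adj_transfer : ∀ v ∈ S, ∀ w ∈ S, ∀ v' ∈ S', ∀ w' ∈ S', m v = m' v' → m w = m' w' →
      (sqNormInt (v - w) = N ↔ sqNormInt (v' - w') = N') := by
    intro v hv w hw v' hv' w' hw' h1 h2
    rw [← C4 v hv w hw, ← C4' v' hv' w' hw', h1, h2]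
  have ne_transfer : ∀ v ∈ S, ∀ w ∈ S, ∀ v' ∈ S', ∀ w' ∈ S', m v = m' v' → m w = m' w' →
      v ≠ w → v' ≠ w' := by
    intro v hv w hw v' hv' w' hw' h1 h2 hne heq
    apply hne
    apply C3 v hv w hw
    rw [h1, h2, heq]
  /- Step B: the orientation bit (sign lemma) and the transfer of squared distances. -/
  have clash : ∀ q ∈ S, ∀ r₁ ∈ S, ∀ q' ∈ S, ∀ r₂ ∈ S, ∀ Q ∈ S', ∀ R₁ ∈ S', ∀ Q' ∈ S', ∀ R₂ ∈ S',
      m q = m' Q → m r₁ = m' R₁ → m q' = m' Q' → m r₂ = m' R₂ →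
      sqNormInt (q - r₁) = N → sqNormInt (Q - R₁) = N' →
      q - r₁ = q' - r₂ → Q - R₁ = R₂ - Q' → False := by
    intro q hq r₁ hr₁ q' hq' r₂ hr₂ Q hQ R₁ hR₁ Q' hQ' R₂ hR₂ h1 h2 h3 h4 hqr hQR hpar hanti
    refine chart_parallel_clash (y := y) hν (s₁ := m q) (s₂ := m r₁) (s₃ := m q') (s₄ := m r₂)
      (C2 q hq).2 (C2 r₁ hr₁).2 (C2 q' hq').2 (C2 r₂ hr₂).2
      (by rw [h1]; exact (C2' Q hQ).2) (by rw [h2]; exact (C2' R₁ hR₁).2)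
      (by rw [h3]; exact (C2' Q' hQ').2) (by rw [h4]; exact (C2' R₂ hR₂).2)
      ?_ ?_ ?_ ?_
    · rw [← scaled_intVec_sub]; exact norm_scaled_intVec hN hqr
    · rw [← scaled_intVec_sub]; exact norm_scaled_intVec hN' hQR
    · rw [← scaled_intVec_sub, ← scaled_intVec_sub, hpar]
    · rw [← scaled_intVec_sub, ← scaled_intVec_sub, hanti]
  have key : ∀ q ∈ S, ∀ q' ∈ S, ∀ Q ∈ S', ∀ Q' ∈ S', m q = m' Q → m q' = m' Q' →
      q ≠ q' → sqNormInt (q - q') ≠ N →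
      sqNormInt (q - q') * N' = sqNormInt (Q - Q') * N := by
    intro q hq q' hq' Q hQ Q' hQ' hmq hmq' hne hnadj
    obtain ⟨hq0, hQ0⟩ := nbr_of_label q hq Q hQ hmq
    obtain ⟨hq'0, hQ'0⟩ := nbr_of_label q' hq' Q' hQ' hmq'
    have hne' : Q ≠ Q' := ne_transfer q hq q' hq' Q hQ Q' hQ' hmq hmq' hne
    have hnadj' : sqNormInt (Q - Q') ≠ N' := fun h =>
      hnadj ((adj_transfer q hq q' hq' Q hQ Q' hQ' hmq hmq').2 h)
    have hnadj'' : sqNormInt (Q' - Q) ≠ N' := by rwa [sqNormInt_sub_comm]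
    -- shorthand for the transfers used below
    have adj := fun (v : Fin 3 → ℤ) (hv : v ∈ S) (w : Fin 3 → ℤ) (hw : w ∈ S)
        (v' : Fin 3 → ℤ) (hv' : v' ∈ S') (w' : Fin 3 → ℤ) (hw' : w' ∈ S')
        (h1 : m v = m' v') (h2 : m w = m' w') (h : sqNormInt (v - w) = N) =>
      (adj_transfer v hv w hw v' hv' w' hw' h1 h2).1 h
    have nadj := fun (v : Fin 3 → ℤ) (hv : v ∈ S) (w : Fin 3 → ℤ) (hw : w ∈ S)
        (v' : Fin 3 → ℤ) (hv' : v' ∈ S') (w' : Fin 3 → ℤ) (hw' : w' ∈ S')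
        (h1 : m v = m' v') (h2 : m w = m' w') (h : sqNormInt (v - w) ≠ N)
        (h' : sqNormInt (v' - w') = N') => h ((adj_transfer v hv w hw v' hv' w' hw' h1 h2).2 h')
    rcases hX v₀ hv₀ q hq hq0 q' hq' ⟨hq'0, hne, hnadj⟩ with
      ⟨r, hr, hr0, hqr, hq'r, hd⟩ |
      ⟨r₁, hr₁, r₂, hr₂, hr₁0, hr₂0, hq'r₁, hqr₁, hr₂q, hr₂q', hqr₂, hq'r₂, hr₁r₂, hd⟩ |
      ⟨r₁, hr₁, r₂, hr₂, hr₁0, hr₂0, hqr₁, hq'r₁, hr₂q', hr₂q, hq'r₂, hqr₂, hr₁r₂, hd⟩ |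
      ⟨r₁, hr₁, r₂, hr₂, hr₁0, hr₂0, hr12, hq'r₁, hq'r₂, hqr₁, hqr₂, hd⟩ |
      ⟨r₁, hr₁, r₂, hr₂, hr₁0, hr₂0, hr12, hqr₁, hqr₂, hq'r₁, hq'r₂, hd⟩ |
      ⟨r₁, hr₁, r₂, hr₂, hr₁0, hr₂0, hr12, hqr₁, hq'r₂, hr₁r₂, hq'r₁, hqr₂, hor⟩
    · -- (α)
      obtain ⟨R, hR, hmR, hR0⟩ := transport r hr hr0
      have h := hA' v₀' hv₀' Q hQ hQ0 Q' hQ' ⟨hQ'0, hne', hnadj'⟩ R hR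
        ⟨hR0, adj q hq r hr Q hQ R hR hmq hmR hqr, adj q' hq' r hr Q' hQ' R hR hmq' hmR hq'r⟩
      have h3 : (3 : ℤ) * (sqNormInt (q - q') * N') = 3 * (sqNormInt (Q - Q') * N) := by
        calc (3 : ℤ) * (sqNormInt (q - q') * N') = (3 * sqNormInt (q - q')) * N' := by ring
          _ = 8 * N * N' := by rw [hd]
          _ = (3 * sqNormInt (Q - Q')) * N := by rw [h]; ring
          _ = 3 * (sqNormInt (Q - Q') * N) := by ring
      exact mul_left_cancel₀ (by norm_num) h3
    · -- (β)
      obtain ⟨R₁, hR₁, hmR₁, hR₁0⟩ := transport r₁ hr₁ hr₁0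
      obtain ⟨R₂, hR₂, hmR₂, hR₂0⟩ := transport r₂ hr₂ hr₂0
      have h := hB' v₀' hv₀' Q hQ hQ0 Q' hQ' ⟨hQ'0, hne', hnadj'⟩ R₁ hR₁
        ⟨hR₁0, adj q' hq' r₁ hr₁ Q' hQ' R₁ hR₁ hmq' hmR₁ hq'r₁,
          nadj q hq r₁ hr₁ Q hQ R₁ hR₁ hmq hmR₁ hqr₁⟩
        R₂ hR₂ ⟨hR₂0, ne_transfer r₂ hr₂ q hq R₂ hR₂ Q hQ hmR₂ hmq hr₂q,
          ne_transfer r₂ hr₂ q' hq' R₂ hR₂ Q' hQ' hmR₂ hmq' hr₂q',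
          nadj q hq r₂ hr₂ Q hQ R₂ hR₂ hmq hmR₂ hqr₂,
          nadj q' hq' r₂ hr₂ Q' hQ' R₂ hR₂ hmq' hmR₂ hq'r₂,
          adj r₁ hr₁ r₂ hr₂ R₁ hR₁ R₂ hR₂ hmR₁ hmR₂ hr₁r₂⟩
      rw [hd, h]; ring
    · -- (βᵗ)
      obtain ⟨R₁, hR₁, hmR₁, hR₁0⟩ := transport r₁ hr₁ hr₁0
      obtain ⟨R₂, hR₂, hmR₂, hR₂0⟩ := transport r₂ hr₂ hr₂0
      have h := hB' v₀' hv₀' Q' hQ' hQ'0 Q hQ ⟨hQ0, hne'.symm, hnadj''⟩ R₁ hR₁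
        ⟨hR₁0, adj q hq r₁ hr₁ Q hQ R₁ hR₁ hmq hmR₁ hqr₁,
          nadj q' hq' r₁ hr₁ Q' hQ' R₁ hR₁ hmq' hmR₁ hq'r₁⟩
        R₂ hR₂ ⟨hR₂0, ne_transfer r₂ hr₂ q' hq' R₂ hR₂ Q' hQ' hmR₂ hmq' hr₂q',
          ne_transfer r₂ hr₂ q hq R₂ hR₂ Q hQ hmR₂ hmq hr₂q,
          nadj q' hq' r₂ hr₂ Q' hQ' R₂ hR₂ hmq' hmR₂ hq'r₂,
          nadj q hq r₂ hr₂ Q hQ R₂ hR₂ hmq hmR₂ hqr₂,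
          adj r₁ hr₁ r₂ hr₂ R₁ hR₁ R₂ hR₂ hmR₁ hmR₂ hr₁r₂⟩
      rw [sqNormInt_sub_comm Q' Q] at h
      rw [hd, h]; ring
    · -- (γ)
      obtain ⟨R₁, hR₁, hmR₁, hR₁0⟩ := transport r₁ hr₁ hr₁0
      obtain ⟨R₂, hR₂, hmR₂, hR₂0⟩ := transport r₂ hr₂ hr₂0
      have h := hC' v₀' hv₀' Q hQ hQ0 Q' hQ' ⟨hQ'0, hne', hnadj'⟩ R₁ hR₁
        ⟨hR₁0, adj q' hq' r₁ hr₁ Q' hQ' R₁ hR₁ hmq' hmR₁ hq'r₁,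
          nadj q hq r₁ hr₁ Q hQ R₁ hR₁ hmq hmR₁ hqr₁⟩
        R₂ hR₂ ⟨hR₂0, ne_transfer r₁ hr₁ r₂ hr₂ R₁ hR₁ R₂ hR₂ hmR₁ hmR₂ hr12,
          adj q' hq' r₂ hr₂ Q' hQ' R₂ hR₂ hmq' hmR₂ hq'r₂,
          nadj q hq r₂ hr₂ Q hQ R₂ hR₂ hmq hmR₂ hqr₂⟩
      rw [hd, h]; ring
    · -- (γᵗ)
      obtain ⟨R₁, hR₁, hmR₁, hR₁0⟩ := transport r₁ hr₁ hr₁0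
      obtain ⟨R₂, hR₂, hmR₂, hR₂0⟩ := transport r₂ hr₂ hr₂0
      have h := hC' v₀' hv₀' Q' hQ' hQ'0 Q hQ ⟨hQ0, hne'.symm, hnadj''⟩ R₁ hR₁
        ⟨hR₁0, adj q hq r₁ hr₁ Q hQ R₁ hR₁ hmq hmR₁ hqr₁,
          nadj q' hq' r₁ hr₁ Q' hQ' R₁ hR₁ hmq' hmR₁ hq'r₁⟩
        R₂ hR₂ ⟨hR₂0, ne_transfer r₁ hr₁ r₂ hr₂ R₁ hR₁ R₂ hR₂ hmR₁ hmR₂ hr12,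
          adj q hq r₂ hr₂ Q hQ R₂ hR₂ hmq hmR₂ hqr₂,
          nadj q' hq' r₂ hr₂ Q' hQ' R₂ hR₂ hmq' hmR₂ hq'r₂⟩
      rw [sqNormInt_sub_comm Q' Q] at h
      rw [hd, h]; ring
    · -- (δ): the orientation bit
      obtain ⟨R₁, hR₁, hmR₁, hR₁0⟩ := transport r₁ hr₁ hr₁0
      obtain ⟨R₂, hR₂, hmR₂, hR₂0⟩ := transport r₂ hr₂ hr₂0
      have hQR₁ : sqNormInt (Q - R₁) = N' := adj q hq r₁ hr₁ Q hQ R₁ hR₁ hmq hmR₁ hqr₁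
      have h := hD' v₀' hv₀' Q hQ hQ0 Q' hQ' ⟨hQ'0, hne', hnadj'⟩ R₁ hR₁
        ⟨hR₁0, hQR₁, nadj q' hq' r₁ hr₁ Q' hQ' R₁ hR₁ hmq' hmR₁ hq'r₁⟩
        R₂ hR₂ ⟨hR₂0, ne_transfer r₁ hr₁ r₂ hr₂ R₁ hR₁ R₂ hR₂ hmR₁ hmR₂ hr12,
          adj q' hq' r₂ hr₂ Q' hQ' R₂ hR₂ hmq' hmR₂ hq'r₂,
          nadj r₁ hr₁ r₂ hr₂ R₁ hR₁ R₂ hR₂ hmR₁ hmR₂ hr₁r₂,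
          nadj q hq r₂ hr₂ Q hQ R₂ hR₂ hmq hmR₂ hqr₂⟩
      rcases hor with ⟨hpar, hd⟩ | ⟨hanti, hd⟩ <;> rcases h with ⟨hpar', hd'⟩ | ⟨hanti', hd'⟩
      · rw [hd, hd']; ring
      · exact (clash q hq r₁ hr₁ q' hq' r₂ hr₂ Q hQ R₁ hR₁ Q' hQ' R₂ hR₂ hmq hmR₁ hmq' hmR₂
          hqr₁ hQR₁ hpar hanti').elim
      · refine (clash q hq r₁ hr₁ r₂ hr₂ q' hq' Q hQ R₁ hR₁ R₂ hR₂ Q' hQ' hmq hmR₁ hmR₂ hmq'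
          hqr₁ hQR₁ hanti ?_).elim
        rw [hpar']
      · rw [hd, hd']; ring
  exact key

end Summit.AtomisticToContinuum.Crystallization.Theorems

end
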